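import Summits.NavierStokesRegularity.NavierStokesRegularity.Theorems.QuarterLogPincerQuietCollarDefs
import Summits.NavierStokesRegularity.NavierStokesRegularity.Theorems.TypeIQuantSubcubicExp.Negative.QuietCollarRestState
import Summits.NavierStokesRegularity.NavierStokesRegularity.Theorems.TypeIQuantSubcubicExp.Negative.QuietCollarWall
import HarnessLib

/-!
# The `quiet_collar` objects, typed — refuter side, negative lane (III): the findings BY NAME

The companion files `Negative/QuietCollarRestState.lean` (p677966) and `Negative/QuietCollarWall.lean`
(p679031) state the refuter's findings on line `Cruxes/TypeIQuantSubcubicExp/Lines/quiet_collar.lean`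
v1.1 (ns-idea-7 g9; sha16 `8170489f8bcaaff9`) over the BODIES of the line's objects, because the Cruxes
workfile is not importable from `Theorems/`. The line's objects have since been landed verbatim at
Theorems level (`QuarterLogPincerQuietCollarDefs`, typer g36, line namespace
`…Cruxes.TypeIQuantSubcubicExp.QuietCollar`), so this file restates every finding BY NAME — each proof
is the body-level theorem, accepted by definitional unfolding (`LocalRateFloor`, `LogCubeLiouville`,
`LogCubeFloorLiouville`, `StubQuietTruncation`, `StubLocalRateFloor`, `StubLogCubeExtraction`,
`QuietCollar`, `CutPair`, `mildDefect`, `StubQuietCollar`, `StubCutPair`). Nothing here asserts 24077,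
24453, 22144, 4050 or a stub of the line; QP1 `stub_quietCollar` is meanwhile a landed theorem
(`QuarterLogPincerQuietCollarLever`, typer g36) and is not used. No summit statement and no crux is
proved by this file.

Findings (see the companion files for the census prose): (F1) item stmt-4050 `TypeIAncientLiouville`
⇒ `StubQuietCollar`, `StubCutPair`, `StubQuietTruncation`, `StubLocalRateFloor`, `LogCubeLiouville`,
`LogCubeFloorLiouville` (consistency ceiling; none refutable short of a nonzero Type-I ancient mild
solution); (F2) `StubLogCubeExtraction ↔ (LogCubeFloorLiouville → TypeIQuantSubcubicExp)`;
(F3) `LogCubeLiouville → LogCubeFloorLiouville` without Q3; (F4) `¬ FiniteDissipationLiouville`,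
`¬ AsymmetricFlickerLiouville`, `¬ TypeIDSSLiouvilleConjecture`, any `IsTypeIDSSProfile c R u`
⇒ `¬ LogCubeFloorLiouville ∧ ¬ LogCubeLiouville`.
-/

-- the summit and its single sub-problem share the name (CONVENTIONS §1), as in every Theorems file
set_option linter.dupNamespace false

namespace Summit.NavierStokesRegularity.NavierStokesRegularity.Theorems.TypeIQuantSubcubicExp.Negative

open Literature.Analysis Literature.Analysis.FluidPDE
open Summit.NavierStokesRegularity.NavierStokesRegularity.Theses
open Summit.NavierStokesRegularity.NavierStokesRegularity.Cruxes.TypeIQuantSubcubicExp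
open Summit.NavierStokesRegularity.NavierStokesRegularity.Cruxes.TypeIQuantSubcubicExp.QuietCollar

/-! ### F1. The consistency ceiling, by name -/

/-- Item stmt-4050 ⇒ QP1 `StubQuietCollar` (by name; CONDITIONAL, 4050 open; QP1 itself is meanwhile
the landed theorem `stub_quietCollar`). [folklore] -/
theorem stubQuietCollar_of_typeIAncientLiouville (h : SymmetryModuliCount.TypeIAncientLiouville) :
    StubQuietCollar :=
  quietCollarStub_of_typeIAncientLiouville h

/-- Item stmt-4050 ⇒ QP2 `StubCutPair` (by name; the rest state is a cut pair). [folklore] -/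
theorem stubCutPair_of_typeIAncientLiouville (h : SymmetryModuliCount.TypeIAncientLiouville) :
    StubCutPair :=
  cutPairStub_of_typeIAncientLiouville h

/-- Item stmt-4050 ⇒ Q1 `StubQuietTruncation` (by name; the rest state is a truncation, `M' = 0`).
[folklore] -/
theorem stubQuietTruncation_of_typeIAncientLiouville (h : SymmetryModuliCount.TypeIAncientLiouville) :
    StubQuietTruncation :=
  quietTruncation_of_typeIAncientLiouville h

/-- Item stmt-4050 ⇒ Q3 `StubLocalRateFloor` (by name). [folklore] -/
theorem stubLocalRateFloor_of_typeIAncientLiouville (h : SymmetryModuliCount.TypeIAncientLiouville) :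
    StubLocalRateFloor :=
  localRateFloorStub_of_typeIAncientLiouville h

/-- Item stmt-4050 ⇒ the value `LogCubeLiouville` (by name). [folklore] -/
theorem logCubeLiouville_of_typeIAncientLiouville' (h : SymmetryModuliCount.TypeIAncientLiouville) :
    LogCubeLiouville :=
  logCubeLiouville_of_typeIAncientLiouville h

/-- Item stmt-4050 ⇒ the value `LogCubeFloorLiouville` (by name). [folklore] -/
theorem logCubeFloorLiouville_of_typeIAncientLiouville' (h : SymmetryModuliCount.TypeIAncientLiouville) :
    LogCubeFloorLiouville :=
  logCubeFloorLiouville_of_typeIAncientLiouville h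

/-- The hypotheses of both values hold at the rest state (every `M ≥ 0`), where both conclusions hold:
neither value is vacuous (by name). [folklore] -/
theorem logCube_values_restState {M : ℝ} (hM : 0 ≤ M) :
    IsTypeIAncientMild M (0 : ℝ → EuclideanSpace ℝ (Fin 3) → EuclideanSpace ℝ (Fin 3)) ∧
      TruncationEdge.EnvelopeCubeBudget (0 : ℝ → EuclideanSpace ℝ (Fin 3) → EuclideanSpace ℝ (Fin 3)) ∧
      ¬ ThinCascade.SingularAt (0 : ℝ → EuclideanSpace ℝ (Fin 3) → EuclideanSpace ℝ (Fin 3)) 0 ∧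
      ¬ LocalRateFloor (0 : ℝ → EuclideanSpace ℝ (Fin 3) → EuclideanSpace ℝ (Fin 3)) :=
  logCube_hypotheses_restState hM

/-! ### F2. Q2 is the converse edge, by name -/

/-- `StubLogCubeExtraction ↔ (LogCubeFloorLiouville → TypeIQuantSubcubicExp)` (by name; pure logic).
[folklore] -/
theorem stubLogCubeExtraction_iff_converse :
    StubLogCubeExtraction ↔ (LogCubeFloorLiouville → QuarterLogPincer.TypeIQuantSubcubicExp) :=
  logCubeExtraction_iff_converse

/-! ### F3. `LogCubeLiouville → LogCubeFloorLiouville` without Q3, by name -/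

/-- `LogCubeLiouville → LogCubeFloorLiouville` with NO use of Q3 (by name). [folklore] -/
theorem logCubeFloorLiouville_of_logCubeLiouville' (h : LogCubeLiouville) : LogCubeFloorLiouville :=
  logCubeFloorLiouville_of_logCubeLiouville h

/-- A localised Leray floor forces a singular point in the closed unit ball (by name). [folklore] -/
theorem exists_singularAt_of_localRateFloor' {v : ℝ → EuclideanSpace ℝ (Fin 3) → EuclideanSpace ℝ (Fin 3)}
    (h : LocalRateFloor v) :
    ∃ a ∈ Metric.closedBall (0 : EuclideanSpace ℝ (Fin 3)) 1, ThinCascade.SingularAt v a :=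
  exists_singularAt_of_localRateFloor h

/-! ### F4. Wall placement, by name -/

/-- `¬ FiniteDissipationLiouville (22144) → ¬ LogCubeFloorLiouville ∧ ¬ LogCubeLiouville` (by name).
[folklore] -/
theorem not_logCube_values_of_not_finiteDissipationLiouville
    (h : ¬ LerayQuarterDissipation.FiniteDissipationLiouville) :
    ¬ LogCubeFloorLiouville ∧ ¬ LogCubeLiouville :=
  ⟨not_logCubeFloorLiouville_of_not_finiteDissipationLiouville h,
    not_logCubeLiouville_of_not_finiteDissipationLiouville h⟩

/-- `¬ AsymmetricFlickerLiouville (24453) → ¬ LogCubeFloorLiouville ∧ ¬ LogCubeLiouville` (by name).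
[folklore] -/
theorem not_logCube_values_of_not_asymmetricFlickerLiouville
    (h : ¬ CalmSliceGate.AsymmetricFlickerLiouville) :
    ¬ LogCubeFloorLiouville ∧ ¬ LogCubeLiouville :=
  ⟨not_logCubeFloorLiouville_of_not_asymmetricFlickerLiouville h,
    not_logCubeLiouville_of_not_asymmetricFlickerLiouville h⟩

/-- `¬ TypeIDSSLiouvilleConjecture → ¬ LogCubeFloorLiouville ∧ ¬ LogCubeLiouville` (by name). [folklore] -/
theorem not_logCube_values_of_not_typeIDSSLiouvilleConjecture
    (h : ¬ _root_.Summit.NavierStokesRegularity.NavierStokesRegularity.TypeIDSSLiouvilleConjecture) :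
    ¬ LogCubeFloorLiouville ∧ ¬ LogCubeLiouville :=
  ⟨not_logCubeFloorLiouville_of_not_typeIDSSLiouvilleConjecture h,
    fun hL => not_logCubeFloorLiouville_of_not_typeIDSSLiouvilleConjecture h
      (logCubeFloorLiouville_of_logCubeLiouville hL)⟩

/-- INSTRUMENT ROW AS THEOREM (by name): a Type-I (rotated-)DSS profile of ANY ratio `c > 1` and any
isometry `R` refutes both values of the line. [folklore] -/
theorem not_logCube_values_of_isTypeIDSSProfile {c : ℝ}
    {R : EuclideanSpace ℝ (Fin 3) ≃ₗᵢ[ℝ] EuclideanSpace ℝ (Fin 3)}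
    {u : ℝ → EuclideanSpace ℝ (Fin 3) → EuclideanSpace ℝ (Fin 3)} (h : IsTypeIDSSProfile c R u) :
    ¬ LogCubeFloorLiouville ∧ ¬ LogCubeLiouville :=
  ⟨not_logCubeFloorLiouville_of_isTypeIDSSProfile h, not_logCubeLiouville_of_isTypeIDSSProfile h⟩

end Summit.NavierStokesRegularity.NavierStokesRegularity.Theorems.TypeIQuantSubcubicExp.Negative
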